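import Summits.SmoothPoincare4.SmoothPoincare4.Theses.DottedCircleRasmussen
import Summits.SmoothPoincare4.SmoothPoincare4.Theorems.DottedCircleRasmussenDcrGfgmw
import Summits.SmoothPoincare4.SmoothPoincare4.Theorems.DcrGap.Negative.NoDiscNormalForm
import Summits.SmoothPoincare4.SmoothPoincare4.Theorems.DcrGap.Negative.KZeroIsFgmw
import Literature.Topology.FourManifolds.SliceDiscInTransport
import Literature.Topology.FourManifolds.SphereSimplyConnected
import Literature.Topology.FourManifolds.HomotopyBallSliceSphereProofs
import Literature.Topology.FourManifolds.EquidimensionalEmbedding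

/-!
# `DcrRigidity` — negative side I: what a disproof of the kill switch must produce

Support lemmas for the crux `Summit.SmoothPoincare4.SmoothPoincare4.Theses.DottedCircleRasmussen.DcrRigidity`
(stmt-SmoothPoincare4-17014, the KILL SWITCH `¬ DcrGap` of route `DottedCircleRasmussen`), from the
standing disprover's work file `Cruxes/DcrRigidity/Disproof.lean` (theorems only; nothing here
concludes the crux or any route item positively).

A DISPROOF of the kill switch is, by name, a proof of the one-handle slice gap `DcrGap`
(`not_dcrRigidity_iff`): a model knot `K ⊂ ∂D_k`, a homotopy 4-sphere `M` with a slice datum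
`(e, f)` for `K` off `e(D_k)`, and the no-disc clause over every `N ≅ S⁴` — in normal form, NO
model slice disc for `K` in `ℝ⁴ ∖ D_k` (`not_dcrRigidity_iff_modelForm`, from the landed
`DcrGap.Negative.dcrGap_iff_modelForm`).  This file pins HOW EXOTIC the witnessing sphere `M` of
any disproof has to be:

* `not_spc4_of_not_dcrRigidity`, `exists_exotic_of_not_dcrRigidity` — a disproof disproves the
  summit: `M` admits no diffeomorphism to `S⁴` (else `N := M` violates the no-disc clause);
* `exists_nonInvertible_of_not_dcrRigidity` (main) — sharper and invariant-free: NO PUNCTURE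
  `M ∖ {q}` of `M` embeds smoothly in `S⁴` (nor in `ℝ⁴`, `…_euclidean`), for ANY point `q`.  That
  is, `M` is a NON-INVERTIBLE homotopy sphere (`M # T ≇ S⁴` for every `T`; equivalently `M` is not
  of the form `B ∪ B⁴` for a Schoenflies ball `B ⊂ S⁴`): by Freedman–Gompf–Morrison–Walker's
  splitting `SPC4 ⟺ (every homotopy 4-sphere is invertible) ∧ Schoenflies⁴` (§1, footnote 1), a
  disproof of this crux must refute the INVERTIBILITY half — the Schoenflies half is irrelevant to
  it, and every candidate `(Σ, e, f)` for the route's engine dies as soon as one puncture of `Σ`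
  is shown to embed in `ℝ⁴` (`not_forall_punctureEmbeds_of_not_dcrRigidity`);
* `not_dcrRigidity_of_isHomotopyBallSlice_not_isSmoothlySlice` — conversely the cheapest
  conceivable disproof is an FGMW certificate (a knot slice in a homotopy 4-ball but not in `B⁴`),
  the `k = 0` layer (landed `DcrGap.Negative.isSmoothlySlice_of_isHomotopyBallSlice_of_not_dcrGap`).

The geometric input is elementary and proved here for the dotted handlebody `D_k` exactly as the
tree proves it for the unit ball (`Knot.IsSliceDiscIn.exists_notMem_range`,
`SliceDiscInTransport.lean`): a slice datum only sees its chart on `B̄(0, 40(k+1)+1) ⊇ D_k`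
(`isSliceDiscInComplement_congr_chart`), the chart can be shrunk outside that ball
(`exists_isSmoothEmbedding_eqOn_closedBall`), a smooth 2-disc misses far-out points of a 4-chart
(dimension count, `exists_lt_norm_apply_notMem_range`) and Milnor's homogeneity lemma moves the
missed point anywhere (`exists_isSliceDiscInComplement_notMem_range`); then a datum off `q`
corestricts to the open submanifold `M ∖ {q}` and travels along any smooth embedding of it into
`S⁴` (`exists_isSliceDiscInComplement_sphere_of_punctureEmbeds`, the transplant of idea card
`Cruxes/DcrRigidity/Ideas/invertible-sphere-transplant.md`).

References: M. Freedman, R. Gompf, S. Morrison, K. Walker, *Man and machine thinking about the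
smooth 4-dimensional Poincaré conjecture*, Quantum Topol. 1 (2010), §1 and footnote 1
[FreedmanGompfMorrisonWalker2010]; J. Milnor, *Topology from the Differentiable Viewpoint* (1965),
§4 Homogeneity Lemma [MilnorTDV1965]; R. Palais, Proc. AMS 11 (1960), Thm. B [Palais1960];
C. Manolescu, M. Marengon, S. Sarkar, M. Willis, Duke Math. J. 172 (2023), §9.3
[ManolescuMarengonSarkarWillis2023].
-/

noncomputable section

-- The namespace is prescribed by the crux protocol (`Summit.<P>.<Sub>.Theorems.<Crux>.Negative`
-- with `P = Sub = SmoothPoincare4`), hence the duplicated component.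
set_option linter.dupNamespace false

open scoped Manifold ContDiff Topology
open Function Set Metric Module
open Literature.Topology.FourManifolds Literature.Topology.FourManifolds.MMSW
open Summit.SmoothPoincare4.SmoothPoincare4.Theses.DottedCircleRasmussen

namespace Summit.SmoothPoincare4.SmoothPoincare4.Theorems.DcrRigidity.Negative

/-! ## §0 The shape of a disproof -/

/-- **A disproof of the kill switch is a proof of the one-handle slice gap**, by name
(`DcrRigidity := ¬ DcrGap`). [folklore] -/
theorem not_dcrRigidity_iff : ¬ DcrRigidity ↔ DcrGap := not_not

/-- **… in normal form**: some model knot `K ⊂ ∂D_k` is slice off `e(D_k)` in some homotopy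
4-sphere but bounds NO smooth proper disc in `ℝ⁴ ∖ D_k` (all carrier / atlas / chart / chirality
freedom of the no-disc clause absorbed by Palais' disc theorem; landed
`DcrGap.Negative.dcrGap_iff_modelForm`). [cite: Palais1960, Thm. B] -/
theorem not_dcrRigidity_iff_modelForm :
    ¬ DcrRigidity ↔ ∃ (k : ℕ)
      (K : (Metric.sphere (0 : EuclideanSpace ℝ (Fin 2)) 1) → EuclideanSpace ℝ (Fin 4)),
      IsModelKnot k K ∧
      (∃ (M : Type) (_ : TopologicalSpace M) (_ : T2Space M) (_ : SecondCountableTopology M)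
          (_ : ChartedSpace (EuclideanSpace ℝ (Fin 4)) M) (_ : IsManifold (𝓡 4) ∞ M),
          Nonempty (ContinuousMap.HomotopyEquiv M (Metric.sphere (0 : EuclideanSpace ℝ (Fin 5)) 1)) ∧
            ∃ (e : EuclideanSpace ℝ (Fin 4) → M) (f : EuclideanSpace ℝ (Fin 2) → M),
              IsSliceDiscInComplement k K M e f) ∧
      ∀ g, ¬ IsModelSliceDisc k K g :=
  not_not.trans DcrGap.Negative.dcrGap_iff_modelForm

/-- **A disproof of the kill switch disproves the summit** (`SmoothPoincare4 → DcrRigidity` is the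
contrapositive of the route's certified deciding theorem `closes`). [folklore] -/
theorem not_spc4_of_not_dcrRigidity (h : ¬ DcrRigidity) : ¬ _root_.SmoothPoincare4 :=
  fun hS => h fun hX => closes hX hS

/-- **The cheapest conceivable disproof is an FGMW certificate**: a knot that is slice in a
homotopy 4-ball but not in `B⁴` refutes the kill switch (its `k = 0` layer; contrapositive of the
landed `DcrGap.Negative.isSmoothlySlice_of_isHomotopyBallSlice_of_not_dcrGap`).
[cite: FreedmanGompfMorrisonWalker2010, §1] -/
theorem not_dcrRigidity_of_isHomotopyBallSlice_not_isSmoothlySlice (K : Knot)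
    (hb : K.IsHomotopyBallSlice) (hs : ¬ K.IsSmoothlySlice) : ¬ DcrRigidity := fun hR =>
  hs (DcrGap.Negative.isSmoothlySlice_of_isHomotopyBallSlice_of_not_dcrGap hR K hb)

/-! ## §1 Re-choosing a slice datum off a point -/

section Datum

variable {X : Type*} [TopologicalSpace X] [ChartedSpace (EuclideanSpace ℝ (Fin 4)) X] {k : ℕ}
  {K : (Metric.sphere (0 : EuclideanSpace ℝ (Fin 2)) 1) → EuclideanSpace ℝ (Fin 4)}
  {e : EuclideanSpace ℝ (Fin 4) → X} {f : EuclideanSpace ℝ (Fin 2) → X}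

/-- **Slice data only see the chart on the ball `B̄(0, 40(k+1)+1) ⊇ D_k`.** If `(e, f)` is a
slice datum for the circle `K ⊂ ∂D_k` and `e'` is another smooth embedding `ℝ⁴ ↪ X` agreeing with
`e` on that closed ball, then `(e', f)` is a slice datum too: `e'(D_k) = e(D_k)`
(`DcrGfgmw.norm_le_of_mem_modelHandlebody`) and `e' ∘ K = e ∘ K`. The `D_k`-analogue of the tree's
`Knot.IsSliceDiscIn.congr_ball`. [folklore] -/
theorem isSliceDiscInComplement_congr_chart (h : IsSliceDiscInComplement k K X e f)
    (hK : ∀ t, K t ∈ modelBoundary k) {e' : EuclideanSpace ℝ (Fin 4) → X}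
    (he' : Manifold.IsSmoothEmbedding (𝓡 4) (𝓡 4) ∞ e')
    (hee' : ∀ w, ‖w‖ ≤ 40 * ((k : ℝ) + 1) + 1 → e' w = e w) :
    IsSliceDiscInComplement k K X e' f := by
  obtain ⟨-, hf, hinj, hmf, hproper, hbdry⟩ := h
  have himg : e' '' modelHandlebody k = e '' modelHandlebody k := by
    refine Subset.antisymm ?_ ?_
    · rintro _ ⟨w, hw, rfl⟩
      exact ⟨w, hw, (hee' w (DcrGfgmw.norm_le_of_mem_modelHandlebody hw)).symm⟩
    · rintro _ ⟨w, hw, rfl⟩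
      exact ⟨w, hw, hee' w (DcrGfgmw.norm_le_of_mem_modelHandlebody hw)⟩
  refine ⟨he', hf, hinj, hmf, fun x hx => ?_, fun t => ?_⟩
  · rw [himg]
    exact hproper x hx
  · rw [hbdry t, hee' _ (DcrGfgmw.norm_le_of_mem_modelHandlebody
      (modelBoundary_subset_modelHandlebody (hK t)))]

/-- **Shrinking a chart outside a closed ball.** For every smooth embedding `e : ℝ⁴ ↪ X` and every
`R > 0` there is a smooth embedding `e' : ℝ⁴ ↪ X` which AGREES with `e` on `B̄(0, R)` and whose
whole range lies in `e(B(0, 8R))`: conjugate the tree's `exists_isSmoothEmbedding_eqOn_ball`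
(agreement on `B(0, 8)`, range in the image of `B(0, 32)`) by the homothety of ratio `R/4`.
[folklore] -/
theorem exists_isSmoothEmbedding_eqOn_closedBall [IsManifold (𝓡 4) ∞ X]
    (he : Manifold.IsSmoothEmbedding (𝓡 4) (𝓡 4) ∞ e) {R : ℝ} (hR : 0 < R) :
    ∃ e' : EuclideanSpace ℝ (Fin 4) → X, Manifold.IsSmoothEmbedding (𝓡 4) (𝓡 4) ∞ e' ∧
      (∀ w, ‖w‖ ≤ R → e' w = e w) ∧ range e' ⊆ e '' ball 0 (8 * R) := by
  obtain ⟨c, hc⟩ : ∃ c : ℝ, c = R / 4 := ⟨_, rfl⟩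
  have hc0 : 0 < c := by rw [hc]; positivity
  set L : EuclideanSpace ℝ (Fin 4) ≃L[ℝ] EuclideanSpace ℝ (Fin 4) :=
    ContinuousLinearEquiv.equivOfInverse
      (c • ContinuousLinearMap.id ℝ (EuclideanSpace ℝ (Fin 4)))
      (c⁻¹ • ContinuousLinearMap.id ℝ (EuclideanSpace ℝ (Fin 4)))
      (fun w => by simp [smul_smul, hc0.ne']) (fun w => by simp [smul_smul, hc0.ne']) with hL
  have hLw : ∀ w, L w = c • w := fun w => rfl
  have hLsw : ∀ w, L.symm w = c⁻¹ • w := fun w => rfl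
  have h1 : Manifold.IsSmoothEmbedding (𝓡 4) (𝓡 4) ∞
      (e ∘ (L : EuclideanSpace ℝ (Fin 4) → EuclideanSpace ℝ (Fin 4))) :=
    he.comp_diffeomorph L.toDiffeomorph
  obtain ⟨e₁, he₁, hee₁, hr₁⟩ := exists_isSmoothEmbedding_eqOn_ball h1
  refine ⟨e₁ ∘ (L.symm : EuclideanSpace ℝ (Fin 4) → EuclideanSpace ℝ (Fin 4)),
    he₁.comp_diffeomorph L.symm.toDiffeomorph, fun w hw => ?_, ?_⟩
  · have hlt : ‖L.symm w‖ < 8 := by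
      rw [hLsw, norm_smul, norm_inv, Real.norm_of_nonneg hc0.le, inv_mul_lt_iff₀ hc0]
      rw [hc]
      linarith [norm_nonneg w]
    change e₁ (L.symm w) = e w
    rw [hee₁ _ hlt]
    change e (L (L.symm w)) = e w
    rw [L.apply_symm_apply]
  · rintro _ ⟨w, rfl⟩
    obtain ⟨u, hu, hu'⟩ := hr₁ ⟨L.symm w, rfl⟩
    refine ⟨L u, ?_, hu'⟩
    rw [mem_ball_zero_iff] at hu ⊢
    rw [hLw, norm_smul, Real.norm_of_nonneg hc0.le]
    calc c * ‖u‖ < c * 32 := by gcongr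
      _ = 8 * R := by rw [hc]; ring

/-- **Slice data with images in an open subset are slice data in the open submanifold**
(corestriction of the chart, `Manifold.IsSmoothEmbedding.codRestrict_opens`; the manifold
derivative of a corestriction is that of the map, `mfderiv_codRestrict_opens_eq`). The
`D_k`-analogue of the tree's `Knot.IsSliceDiscIn.codRestrict`. [folklore] -/
theorem isSliceDiscInComplement_codRestrict [IsManifold (𝓡 4) ∞ X]
    (h : IsSliceDiscInComplement k K X e f) (U : TopologicalSpace.Opens X)
    (heU : ∀ v, e v ∈ U) (hfU : ∀ y, f y ∈ U) :
    IsSliceDiscInComplement k K U (fun v => (⟨e v, heU v⟩ : U))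
      (fun y => (⟨f y, hfU y⟩ : U)) := by
  obtain ⟨he, hf, hinj, hmf, hproper, hbdry⟩ := h
  refine ⟨he.codRestrict_opens U heU, (ContMDiff.subtypeVal_comp_iff U _).1 hf,
    fun x hx y hy hxy => hinj hx hy (congrArg Subtype.val hxy), fun x hx => ?_, fun x hx => ?_,
    fun x => Subtype.ext (hbdry x)⟩
  · rw [mfderiv_codRestrict_opens_eq (f := f) (g := fun y => (⟨f y, hfU y⟩ : U)) (fun y => rfl)
      ((hf x).mdifferentiableAt (by simp))]
    exact hmf x hx
  · rintro ⟨v, hv, hfv⟩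
    exact hproper x hx ⟨v, hv, congrArg Subtype.val hfv⟩

/-- **A slice datum can be moved off any point of a connected 4-manifold.** Given a slice datum
`(e, f)` for the circle `K ⊂ ∂D_k` in the connected smooth 4-manifold `X` and a point `x₀`, there
is a slice datum `(e', f')` for `K` in `X` whose chart and disc both miss `x₀`. Proof: shrink the
chart outside `B̄(0, R) ⊇ D_k`, `R = 40(k+1)+1` (`exists_isSmoothEmbedding_eqOn_closedBall`: range
in `e(B(0, 8R))`, datum unchanged by `isSliceDiscInComplement_congr_chart`); by the dimension count
(`exists_lt_norm_apply_notMem_range`) some `x₁ = e v`, `‖v‖ > 8R`, is neither on `f(ℝ²)` nor in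
the shrunk chart; Milnor's homogeneity lemma (`exists_diffeomorph_apply_eq_forall_isOrientationPreserving`)
moves `x₁` to `x₀`, and data travel along diffeomorphisms
(`DcrGfgmw.isSliceDiscInComplement_comp_diffeomorph`). The `D_k`-analogue of the tree's
`Knot.IsSliceDiscIn.exists_notMem_range`. [cite: MilnorTDV1965, §4, Homogeneity Lemma] -/
theorem exists_isSliceDiscInComplement_notMem_range [T2Space X] [IsManifold (𝓡 4) ∞ X]
    [ConnectedSpace X] (h : IsSliceDiscInComplement k K X e f)
    (hK : ∀ t, K t ∈ modelBoundary k) (x₀ : X) :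
    ∃ (e' : EuclideanSpace ℝ (Fin 4) → X) (f' : EuclideanSpace ℝ (Fin 2) → X),
      IsSliceDiscInComplement k K X e' f' ∧ x₀ ∉ range e' ∧ x₀ ∉ range f' := by
  have hR : (0 : ℝ) < 40 * ((k : ℝ) + 1) + 1 := by positivity
  obtain ⟨e₁, he₁, hee₁, hr₁⟩ := exists_isSmoothEmbedding_eqOn_closedBall h.1 hR
  obtain ⟨v, hv, hvf⟩ := exists_lt_norm_apply_notMem_range (m := 2) (n := 4) (X := X)
    (by norm_num) h.1 h.2.1 (8 * (40 * ((k : ℝ) + 1) + 1))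
  obtain ⟨φ, hφ, -⟩ :=
    exists_diffeomorph_apply_eq_forall_isOrientationPreserving (n := 4) (e v) x₀
  have h₁ : IsSliceDiscInComplement k K X e₁ f := isSliceDiscInComplement_congr_chart h hK he₁ hee₁
  refine ⟨φ ∘ e₁, φ ∘ f, DcrGfgmw.isSliceDiscInComplement_comp_diffeomorph h₁ φ, ?_, ?_⟩
  · rintro ⟨w, hw⟩
    rw [← hφ] at hw
    obtain ⟨u, hu, hu'⟩ := hr₁ ⟨w, rfl⟩
    have hu1 : u = v := h.1.isEmbedding.injective (hu'.trans (φ.injective hw))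
    rw [mem_ball_zero_iff, hu1] at hu
    linarith
  · rintro ⟨y, hy⟩
    rw [← hφ] at hy
    exact hvf ⟨y, φ.injective hy⟩

/-! ## §2 The transplant through an `S⁴`-embeddable puncture -/

/-- **Transplant.** If the circle `K ⊂ ∂D_k` has a slice datum off `e(D_k)` in a connected smooth
4-manifold `X`, and SOME puncture `X ∖ {q}` embeds smoothly in `S⁴`, then `K` has a slice datum
in `S⁴` (for the composed chart): move the datum off `q`
(`exists_isSliceDiscInComplement_notMem_range`), corestrict to the open submanifold `X ∖ {q}`
(`isSliceDiscInComplement_codRestrict`) and compose with the embedding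
(`DcrGfgmw.isSliceDiscInComplement_comp`). First lemma of idea card
`invertible-sphere-transplant`. [cite: FreedmanGompfMorrisonWalker2010, §1] -/
theorem exists_isSliceDiscInComplement_sphere_of_punctureEmbeds [T2Space X]
    [IsManifold (𝓡 4) ∞ X] [ConnectedSpace X] (h : IsSliceDiscInComplement k K X e f)
    (hK : ∀ t, K t ∈ modelBoundary k) (q : X)
    {ι : ↥((⟨{q}ᶜ, isOpen_compl_singleton⟩ : TopologicalSpace.Opens X)) →
      Metric.sphere (0 : EuclideanSpace ℝ (Fin 5)) 1}
    (hι : Manifold.IsSmoothEmbedding (𝓡 4) (𝓡 4) ∞ ι) :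
    ∃ (e' : EuclideanSpace ℝ (Fin 4) → Metric.sphere (0 : EuclideanSpace ℝ (Fin 5)) 1)
      (f' : EuclideanSpace ℝ (Fin 2) → Metric.sphere (0 : EuclideanSpace ℝ (Fin 5)) 1),
      IsSliceDiscInComplement k K (Metric.sphere (0 : EuclideanSpace ℝ (Fin 5)) 1) e' f' := by
  obtain ⟨e₁, f₁, h₁, hqe, hqf⟩ := exists_isSliceDiscInComplement_notMem_range h hK q
  have heU : ∀ v, e₁ v ∈ ((⟨{q}ᶜ, isOpen_compl_singleton⟩ : TopologicalSpace.Opens X)) := by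
    intro v (hv : e₁ v ∈ ({q} : Set X))
    exact hqe ⟨v, hv⟩
  have hfU : ∀ y, f₁ y ∈ ((⟨{q}ᶜ, isOpen_compl_singleton⟩ : TopologicalSpace.Opens X)) := by
    intro y (hy : f₁ y ∈ ({q} : Set X))
    exact hqf ⟨y, hy⟩
  exact ⟨_, _, DcrGfgmw.isSliceDiscInComplement_comp
    (isSliceDiscInComplement_codRestrict h₁ _ heU hfU) hι⟩

/-- **Transplant, Euclidean target**: the same with the puncture embedded in `ℝ⁴` — an
equidimensional smooth embedding has open range (it is a local diffeomorphism,
`Manifold.IsSmoothEmbedding.isLocalDiffeomorph_of_finrank_eq`), so it composes with the round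
ball `σ⁻¹ : ℝ⁴ ↪ S⁴` (`isSmoothEmbedding_stereographic'_symm`, `IsSmoothEmbedding.comp_of_isOpen_range`).
[cite: FreedmanGompfMorrisonWalker2010, §1] -/
theorem exists_isSliceDiscInComplement_sphere_of_punctureEmbeds_euclidean [T2Space X]
    [IsManifold (𝓡 4) ∞ X] [ConnectedSpace X] (h : IsSliceDiscInComplement k K X e f)
    (hK : ∀ t, K t ∈ modelBoundary k) (q : X)
    {ι : ↥((⟨{q}ᶜ, isOpen_compl_singleton⟩ : TopologicalSpace.Opens X)) → EuclideanSpace ℝ (Fin 4)}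
    (hι : Manifold.IsSmoothEmbedding (𝓡 4) (𝓡 4) ∞ ι) :
    ∃ (e' : EuclideanSpace ℝ (Fin 4) → Metric.sphere (0 : EuclideanSpace ℝ (Fin 5)) 1)
      (f' : EuclideanSpace ℝ (Fin 2) → Metric.sphere (0 : EuclideanSpace ℝ (Fin 5)) 1),
      IsSliceDiscInComplement k K (Metric.sphere (0 : EuclideanSpace ℝ (Fin 5)) 1) e' f' := by
  letI := Knot.fact_finrank_euclideanSpace_four_add_one
  obtain ⟨a⟩ : Nonempty (Metric.sphere (0 : EuclideanSpace ℝ (Fin 5)) 1) :=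
    ⟨⟨EuclideanSpace.single 0 1, by simp⟩⟩
  have hσ := isSmoothEmbedding_stereographic'_symm (n := 4) a
  have hιo : IsOpen (range ι) :=
    (hι.isLocalDiffeomorph_of_finrank_eq rfl).isOpen_range
  exact exists_isSliceDiscInComplement_sphere_of_punctureEmbeds h hK q
    (IsSmoothEmbedding.comp_of_isOpen_range hσ hι hιo)

end Datum

/-! ## §3 The witnessing sphere of a disproof is exotic and non-invertible -/

/-- **A disproof of the kill switch produces an exotic 4-sphere**: the homotopy sphere `M` of the
slice gap admits no diffeomorphism to `S⁴` (landed `DcrGap.Negative.isEmpty_diffeomorph_of_witness`).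
[cite: FreedmanGompfMorrisonWalker2010, §1] -/
theorem exists_exotic_of_not_dcrRigidity (h : ¬ DcrRigidity) :
    ∃ (M : Type) (_ : TopologicalSpace M) (_ : T2Space M) (_ : SecondCountableTopology M)
      (_ : ChartedSpace (EuclideanSpace ℝ (Fin 4)) M) (_ : IsManifold (𝓡 4) ∞ M),
      Nonempty (ContinuousMap.HomotopyEquiv M (Metric.sphere (0 : EuclideanSpace ℝ (Fin 5)) 1)) ∧
        IsEmpty (M ≃ₘ⟮𝓡 4, 𝓡 4⟯ (Metric.sphere (0 : EuclideanSpace ℝ (Fin 5)) 1)) := by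
  obtain ⟨k, K, -, ⟨M, i1, i2, i3, i4, i5, hM, e, f, hef⟩, hno⟩ := not_dcrRigidity_iff.1 h
  exact ⟨M, i1, i2, i3, i4, i5, hM, ⟨fun Φ => hno M ⟨Φ⟩ e f hef⟩⟩

/-- **MAIN: a disproof of the kill switch produces a NON-INVERTIBLE homotopy 4-sphere.** If
`DcrRigidity` fails, the witnessing homotopy sphere `M` of the slice gap is exotic AND no puncture
`M ∖ {q}` of it embeds smoothly in `S⁴`, for any `q` — otherwise the slice datum, moved off `q`,
transplants into `S⁴` (`exists_isSliceDiscInComplement_sphere_of_punctureEmbeds`) and violates the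
no-disc clause at `N := S⁴`. Hence (FGMW §1, fn. 1: `SPC4 ⟺` invertibility `∧ Schoenflies⁴`) any
disproof refutes the invertibility half of SPC4; Schoenflies-type input cannot help it, and
no candidate sphere one of whose punctures embeds in `S⁴` can ever witness the gap.
[cite: FreedmanGompfMorrisonWalker2010, §1] -/
theorem exists_nonInvertible_of_not_dcrRigidity (h : ¬ DcrRigidity) :
    ∃ (M : Type) (_ : TopologicalSpace M) (_ : T2Space M) (_ : SecondCountableTopology M)
      (_ : ChartedSpace (EuclideanSpace ℝ (Fin 4)) M) (_ : IsManifold (𝓡 4) ∞ M),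
      Nonempty (ContinuousMap.HomotopyEquiv M (Metric.sphere (0 : EuclideanSpace ℝ (Fin 5)) 1)) ∧
        IsEmpty (M ≃ₘ⟮𝓡 4, 𝓡 4⟯ (Metric.sphere (0 : EuclideanSpace ℝ (Fin 5)) 1)) ∧
        ∀ (q : M) (ι : ↥((⟨{q}ᶜ, isOpen_compl_singleton⟩ : TopologicalSpace.Opens M)) →
            Metric.sphere (0 : EuclideanSpace ℝ (Fin 5)) 1),
          ¬ Manifold.IsSmoothEmbedding (𝓡 4) (𝓡 4) ∞ ι := by
  obtain ⟨k, K, hK, ⟨M, i1, i2, i3, i4, i5, hM, e, f, hef⟩, hno⟩ := not_dcrRigidity_iff.1 h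
  refine ⟨M, i1, i2, i3, i4, i5, hM, ⟨fun Φ => hno M ⟨Φ⟩ e f hef⟩, fun q ι hι => ?_⟩
  haveI : ConnectedSpace M := by
    haveI := simplyConnectedSpace_of_homotopyEquiv_sphere_four
      simplyConnectedSpace_sphere_four_holds M hM.some
    infer_instance
  have hK' : IsModelKnot k K := hK
  have hef' : IsSliceDiscInComplement k K M e f := hef
  obtain ⟨e', f', h'⟩ :=
    exists_isSliceDiscInComplement_sphere_of_punctureEmbeds hef' hK'.mem q hι
  exact hno _ ⟨Diffeomorph.refl _ _ _⟩ e' f' h'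

/-- **Euclidean form: no puncture of the witnessing sphere embeds in `ℝ⁴`** (the shape of the
punctured-embedding / invertibility statements elsewhere in the tree, e.g. for
Kervaire–Milnor connected sums `M # T ≅ S⁴`). [cite: FreedmanGompfMorrisonWalker2010, §1] -/
theorem exists_nonInvertible_of_not_dcrRigidity_euclidean (h : ¬ DcrRigidity) :
    ∃ (M : Type) (_ : TopologicalSpace M) (_ : T2Space M) (_ : SecondCountableTopology M)
      (_ : ChartedSpace (EuclideanSpace ℝ (Fin 4)) M) (_ : IsManifold (𝓡 4) ∞ M),
      Nonempty (ContinuousMap.HomotopyEquiv M (Metric.sphere (0 : EuclideanSpace ℝ (Fin 5)) 1)) ∧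
        IsEmpty (M ≃ₘ⟮𝓡 4, 𝓡 4⟯ (Metric.sphere (0 : EuclideanSpace ℝ (Fin 5)) 1)) ∧
        ∀ (q : M) (ι : ↥((⟨{q}ᶜ, isOpen_compl_singleton⟩ : TopologicalSpace.Opens M)) →
            EuclideanSpace ℝ (Fin 4)),
          ¬ Manifold.IsSmoothEmbedding (𝓡 4) (𝓡 4) ∞ ι := by
  obtain ⟨k, K, hK, ⟨M, i1, i2, i3, i4, i5, hM, e, f, hef⟩, hno⟩ := not_dcrRigidity_iff.1 h
  refine ⟨M, i1, i2, i3, i4, i5, hM, ⟨fun Φ => hno M ⟨Φ⟩ e f hef⟩, fun q ι hι => ?_⟩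
  haveI : ConnectedSpace M := by
    haveI := simplyConnectedSpace_of_homotopyEquiv_sphere_four
      simplyConnectedSpace_sphere_four_holds M hM.some
    infer_instance
  have hK' : IsModelKnot k K := hK
  have hef' : IsSliceDiscInComplement k K M e f := hef
  obtain ⟨e', f', h'⟩ :=
    exists_isSliceDiscInComplement_sphere_of_punctureEmbeds_euclidean hef' hK'.mem q hι
  exact hno _ ⟨Diffeomorph.refl _ _ _⟩ e' f' h'

/-- **INVERTIBILITY WOULD PROVE THE CRUX; a disproof refutes it.** If every smooth homotopy
4-sphere (Statement binders) has SOME puncture that embeds smoothly in `ℝ⁴` ("every homotopy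
4-sphere is invertible", the non-Schoenflies half of SPC4 in Freedman–Gompf–Morrison–Walker's
splitting), then `DcrRigidity` holds; stated negatively, as befits this file.
[cite: FreedmanGompfMorrisonWalker2010, §1] -/
theorem not_forall_punctureEmbeds_of_not_dcrRigidity (h : ¬ DcrRigidity) :
    ¬ ∀ (M : Type) [TopologicalSpace M] [T2Space M] [SecondCountableTopology M]
        [ChartedSpace (EuclideanSpace ℝ (Fin 4)) M] [IsManifold (𝓡 4) ∞ M],
        Nonempty (ContinuousMap.HomotopyEquiv M (Metric.sphere (0 : EuclideanSpace ℝ (Fin 5)) 1)) →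
          ∃ (q : M) (ι : ↥((⟨{q}ᶜ, isOpen_compl_singleton⟩ : TopologicalSpace.Opens M)) →
              EuclideanSpace ℝ (Fin 4)),
            Manifold.IsSmoothEmbedding (𝓡 4) (𝓡 4) ∞ ι := by
  intro hinv
  obtain ⟨M, i1, i2, i3, i4, i5, hM, -, hq⟩ := exists_nonInvertible_of_not_dcrRigidity_euclidean h
  obtain ⟨q, ι, hι⟩ := @hinv M i1 i2 i3 i4 i5 hM
  exact hq q ι hι

end Summit.SmoothPoincare4.SmoothPoincare4.Theorems.DcrRigidity.Negative

end
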